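import Literature.GroupTheory.Abelian.FiniteRankPrimaryGroups
import Literature.GroupTheory.Abelian.DescendingChainCondition
import Mathlib.GroupTheory.Index
import Mathlib.RingTheory.Artinian.Module
import HarnessLib

/-!
# Crux `MazurMCOnX1RankZero` (item stmt-BirchSwinnertonDyer-19035), line `interlude_with_torsion`, road B (B1c):
# input-free algebra for the local discrepancy above `v̄` — `pM` has finite index in a `p`-primary group with finite `M[p]`

Cell `bsd-eis` (host `run/shared/lean/pub/bsd-eis/`), LEAD `cruxlead-19035` (g0); `--supports`
stmt-BirchSwinnertonDyer-19035 as a HELPER. Content = the companion workfile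
`Cruxes/MazurMCOnX1RankZero/Lines/interlude_stepsTwoThree_split_idea11g6_roadB_helpers.lean` rev 1 of the ideator bsd-idea-11
(g15; sorry-free there since 2026-08-29T00:00Z), moved verbatim into the tree: pieces (R3)/CL of the blueprint (memo
`Lines/interlude_K2mu_ArnoldKoo_memo_idea11g14.md` §10) of the registered stub `stub_roadBResidueP` ((B1c) at degree exactly `p`)
of the skeleton v8. Abelian-group algebra, UNCONDITIONAL; NOTHING is asserted about BSD, Mazur's main conjecture or IMC2.

Contents. **CL** (`finiteIndex_range_nsmul_of_finite_torsionBy`): in an abelian group `M` in which every element is killed by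
a power of `p` and whose `p`-torsion `M[p]` is finite, `pM` has finite index — from the tree's Kaplansky library: such an `M` has
the descending chain condition (`Purity.isArtinian_of_finite_torsionBy`), so the bounded quotient `M/pM` is finite
(`Purity.finite_of_isArtinian_of_bounded`). **(R3-alg)** (`finiteIndex_map_inf_of_comp_eq_nsmul`): if `g : A → A'`, `ĝ : A' → A`
satisfy `g ∘ ĝ = p` and `A'` is `p`-primary with finite `A'[p]`, then for subgroups `A₀ ≤ A`, `A'₀ ≤ A'` with `ĝ(A'₀) ≤ A₀` the
subgroup `g(A₀) ⊓ A'₀` has finite index in `A'₀` — applied in (R3) to `A₀ = W[p^∞]^G`, `A'₀ = W'[p^∞]^G`,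
`G = Gal(K̄_v̄ / K_{∞,w̄})`, after identifying `ker (H¹(G, W[ψ₀]) → H¹(G, W[p^∞]))` with `W'[p^∞]^G / ψ₀(W[p^∞]^G)`: the local
discrepancy over `v̄` is finite WITHOUT Imai's theorem. [cite: Kaplansky1954, §15 Exercise 49 (b); §9 Exercise 21]
[cite: GreenbergLNM1716, §5, proof of Prop. 5.10]
-/

set_option linter.dupNamespace false

namespace Summit.BirchSwinnertonDyer.BirchSwinnertonDyer.Theorems.InterludeWithTorsion.RoadBHelpers

open AddSubgroup Literature.GroupTheory.Abelian

universe u v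

variable {M : Type u} [AddCommGroup M]

/-- The range of multiplication by `n` is the `ℤ`-submodule `range (n • id)` seen as a subgroup. [folklore] -/
theorem range_nsmulAddMonoidHom_eq_toAddSubgroup (n : ℕ) :
    (nsmulAddMonoidHom (α := M) n).range =
      (LinearMap.range ((n : ℤ) • (LinearMap.id : M →ₗ[ℤ] M))).toAddSubgroup := by
  ext x
  simp only [AddMonoidHom.mem_range, nsmulAddMonoidHom_apply, Submodule.mem_toAddSubgroup,
    LinearMap.mem_range, LinearMap.smul_apply, LinearMap.id_coe, id_eq, natCast_zsmul]

/-- **CL.** In a `p`-primary abelian group with finite `p`-torsion, `pM` has finite index (`M/pM` is finite): the group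
has the descending chain condition (Kaplansky §15 Ex. 49 (b), tree `Purity.isArtinian_of_finite_torsionBy`), which passes
to the quotient `M/pM`, a group of exponent `p`, hence finite (Kaplansky §9 Ex. 21, tree `Purity.finite_of_isArtinian_of_bounded`).
[cite: Kaplansky1954, §15 Exercise 49 (b) (PDF p. 54); §9 Exercise 21 (PDF p. 24)] -/
theorem finiteIndex_range_nsmul_of_finite_torsionBy {p : ℕ} [hp : Fact p.Prime]
    (hprim : ∀ x : M, ∃ k : ℕ, p ^ k • x = 0) (hfin : ((torsionBy M p : AddSubgroup M) : Set M).Finite) :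
    (nsmulAddMonoidHom (α := M) p).range.FiniteIndex := by
  haveI : IsArtinian ℤ M := Purity.isArtinian_of_finite_torsionBy hprim hfin
  set P : Submodule ℤ M := LinearMap.range ((p : ℤ) • (LinearMap.id : M →ₗ[ℤ] M)) with hP
  haveI : IsArtinian ℤ (M ⧸ P) := isArtinian_of_quotient_of_artinian P
  have hb : ∀ x : M ⧸ P, p • x = 0 := by
    intro x
    obtain ⟨m, rfl⟩ := Submodule.mkQ_surjective P x
    rw [← map_nsmul, Submodule.mkQ_apply, Submodule.Quotient.mk_eq_zero, hP, LinearMap.mem_range]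
    exact ⟨m, by simp⟩
  have hF : Finite (M ⧸ P) := Purity.finite_of_isArtinian_of_bounded (G := M ⧸ P) hp.out.ne_zero hb
  haveI : Finite (M ⧸ P.toAddSubgroup) := hF
  have hPI : P.toAddSubgroup.FiniteIndex := AddSubgroup.finiteIndex_of_finite_quotient
  rwa [range_nsmulAddMonoidHom_eq_toAddSubgroup]

/-- `p`-primarity and finiteness of the `p`-torsion pass to subgroups. [folklore] -/
theorem finite_torsionBy_addSubgroup {p : ℕ} (N : AddSubgroup M)
    (hfin : ((torsionBy M p : AddSubgroup M) : Set M).Finite) :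
    ((torsionBy N p : AddSubgroup N) : Set N).Finite := by
  refine (hfin.preimage (Subtype.val_injective.injOn)).subset ?_
  intro x hx
  rw [SetLike.mem_coe, torsionBy.nsmul_iff] at hx
  rw [Set.mem_preimage, SetLike.mem_coe, torsionBy.nsmul_iff, ← AddSubgroupClass.coe_nsmul, hx,
    ZeroMemClass.coe_zero]

/-- **(R3-alg).** Let `g : A → A'`, `ĝ : A' → A` be homomorphisms with `g (ĝ a') = p • a'`, `A'` `p`-primary with finite
`p`-torsion, and `A₀ ≤ A`, `A'₀ ≤ A'` subgroups with `ĝ(A'₀) ≤ A₀` (intended: the invariants under a Galois group, `g` an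
isogeny of degree `p`, `ĝ` its dual). Then `g(A₀) ⊓ A'₀` has finite index in `A'₀`: it contains `p A'₀`, which has finite index
by CL. This is the algebraic half of memo §10 (R3): the local discrepancy `W'[p^∞]^G / ψ₀(W[p^∞]^G)` over `v̄` is finite with NO
appeal to Imai's theorem. [cite: GreenbergLNM1716, §5, proof of Prop. 5.10] [folklore] -/
theorem finiteIndex_map_inf_of_comp_eq_nsmul {A : Type u} {A' : Type v} [AddCommGroup A] [AddCommGroup A']
    {p : ℕ} [hp : Fact p.Prime] (g : A →+ A') (gd : A' →+ A) (hcomp : ∀ a' : A', g (gd a') = p • a')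
    (hprim : ∀ a' : A', ∃ k : ℕ, p ^ k • a' = 0) (hfin : ((torsionBy A' p : AddSubgroup A') : Set A').Finite)
    (A₀ : AddSubgroup A) (A'₀ : AddSubgroup A') (hgd : ∀ a' ∈ A'₀, gd a' ∈ A₀) :
    ((A₀.map g ⊓ A'₀).addSubgroupOf A'₀).FiniteIndex := by
  -- `A'₀` is `p`-primary with finite `p`-torsion, so `p A'₀` has finite index in it (CL)
  have hprim₀ : ∀ x : A'₀, ∃ k : ℕ, p ^ k • x = 0 := by
    intro x
    obtain ⟨k, hk⟩ := hprim x
    exact ⟨k, Subtype.ext (by exact_mod_cast hk)⟩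
  have hCL := finiteIndex_range_nsmul_of_finite_torsionBy (M := A'₀) hprim₀ (finite_torsionBy_addSubgroup A'₀ hfin)
  -- `p A'₀ ≤ g(A₀) ⊓ A'₀` inside `A'₀`
  have hle : (nsmulAddMonoidHom (α := A'₀) p).range ≤ (A₀.map g ⊓ A'₀).addSubgroupOf A'₀ := by
    rintro x ⟨y, rfl⟩
    rw [mem_addSubgroupOf, nsmulAddMonoidHom_apply, AddSubgroupClass.coe_nsmul, mem_inf]
    refine ⟨?_, A'₀.nsmul_mem y.2 p⟩
    rw [mem_map]
    exact ⟨gd y, hgd y y.2, hcomp y⟩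
  haveI := hCL
  exact AddSubgroup.finiteIndex_of_le hle

end Summit.BirchSwinnertonDyer.BirchSwinnertonDyer.Theorems.InterludeWithTorsion.RoadBHelpers
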